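import Summits.AtomisticToContinuum.HydrodynamicLimit.Theorems.JParityClosureEvenStressEnskogClusterTransportWindow
import Summits.AtomisticToContinuum.HydrodynamicLimit.Theorems.JParityClosureEvenStressEnskogTubeStatRegular
import HarnessLib

/-!
# Cluster transport identity, III: the weight `χ g(σ³ρ_r)` along a free flight
# (helper file of `stub_clusterTransport`, line `stationary-microscale-hierarchy-entrance-law` of the
# crux `JParityClosure.EvenStressEnskog`, stmt-AtomisticToContinuum-13079)

The weight `W(s, x₀, z) = weight σ χ g r s z x₀ = χ(s, x₀) g(σ³ ρ_r(z, x₀))` of the Eulerian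
microscale windows and its free-streaming rate `Ẇ = weightRate` (`= ∂ₛχ g + χ g′ σ³ densRate`) read
at a FIXED centre `x₀` along a free flight `s ↦ S_s w`, for `χ` continuous with a continuous
`s`-derivative and `g ∈ C¹`:

* `hasDerivAt_weight_flight`: `s ↦ W(s, x₀, S_s w)` has the derivative `Ẇ(t, x₀, S_t w)` at every
  good centre of `S_t w` (every particle at distance `≠ 0, r`), and `continuousAt_weightRate_flight`:
  `s ↦ Ẇ(s, x₀, S_s w)` is continuous there (from part I, `hasDerivAt_mollDensity_flight`,
  `continuousAt_densRate_flight`);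
* `continuous_weight_centre`, `continuous_weight_flight`, `measurable_weightRate_centre`;
* quantitative bounds from sup / derivative bounds of `χ` on a time set and of `g` on the range
  `[0, σ³ · 3/(πr³)]` of `σ³ρ_r`: `abs_weight_le`, `abs_weightRate_le`, and the time-Lipschitz bound
  `abs_weight_flight_sub_le`, all uniform in the centre.

References: H. Spohn, *Large Scale Dynamics of Interacting Particles* (1991), Part I §3.2.
Elementary. [folklore]
-/

noncomputable section

open MeasureTheory Set Filter Function Metric
open scoped BigOperators Topology InnerProductSpace

namespace Summit.AtomisticToContinuum.HydrodynamicLimit.Theorems.EvenStressEnskog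

open Literature.Analysis.FluidPDE Literature.Analysis.FunctionSpaces
  Literature.MathematicalPhysics.KineticTheory
  Literature.MathematicalPhysics.KineticTheory.StationaryMicroscale

/-- Translations of the flat `3`-torus are continuous (hypothesis `hG` of the trajectory kit).
[folklore] -/
theorem continuous_translate_torus3 : ∀ x : T3, Continuous ((Torus.geometry (Fin 3)).translate x) :=
  fun _ => continuous_const.add Torus.continuous_proj

/-- The mollified density is continuous along a free flight, at every centre. [folklore] -/
theorem continuous_mollDensity_flight {N : ℕ} (r : ℝ) (w : Config (N + 1) (Fin 3) T3) (x₀ : T3) :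
    Continuous fun s : ℝ => mollDensity r (freeFlight (Torus.geometry (Fin 3)) s w) x₀ :=
  continuous_mollDensity_comp r
    (continuous_freeFlight_of_continuous_translate continuous_translate_torus3 w) continuous_const

section Weight

variable {N : ℕ} (σ : ℝ) {χ : ℝ × T3 → ℝ} {g : ℝ → ℝ} {r : ℝ}

/-! ## Derivative and continuity along a flight -/

/-- **The free-streaming rate of the weight**: for `χ` differentiable in `s`, `g ∈ C¹`,
`0 < r < 1/2` and a good centre of `S_t w`, `s ↦ W(s, x₀, S_s w)` has the derivative
`weightRate σ χ g r t (S_t w) x₀` at `s = t` (chain and product rules with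
`hasDerivAt_mollDensity_flight`). [folklore] -/
theorem hasDerivAt_weight_flight (hχd : ∀ x₀, Differentiable ℝ fun s => χ (s, x₀))
    (hg : ContDiff ℝ 1 g) (hr : 0 < r) (hr2 : r < 1 / 2) (w : Config (N + 1) (Fin 3) T3) (t : ℝ)
    {x₀ : T3}
    (hx : ∀ k, Torus.euclidDist ((freeFlight (Torus.geometry (Fin 3)) t w) k).1 x₀ ≠ 0 ∧
      Torus.euclidDist ((freeFlight (Torus.geometry (Fin 3)) t w) k).1 x₀ ≠ r) :
    HasDerivAt (fun s : ℝ => weight σ χ g r s (freeFlight (Torus.geometry (Fin 3)) s w) x₀)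
      (weightRate σ χ g r t (freeFlight (Torus.geometry (Fin 3)) t w) x₀) t := by
  have hρ := hasDerivAt_mollDensity_flight hr hr2 w t hx
  have hσρ := hρ.const_mul (σ ^ 3)
  have hgd : HasDerivAt g
      (deriv g (σ ^ 3 * mollDensity r (freeFlight (Torus.geometry (Fin 3)) t w) x₀))
      (σ ^ 3 * mollDensity r (freeFlight (Torus.geometry (Fin 3)) t w) x₀) :=
    ((hg.differentiable one_ne_zero) _).hasDerivAt
  have hcomp := hgd.comp t hσρ
  have hχ' := ((hχd x₀) t).hasDerivAt
  have hprod := hχ'.mul hcomp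
  unfold weight weightRate
  refine (hprod.congr_deriv ?_).congr_of_eventuallyEq (Eventually.of_forall fun s => rfl)
  simp only [Function.comp_def]
  ring

/-- The weight is continuous along a flight, at every centre. [folklore] -/
theorem continuous_weight_flight (hχ : Continuous χ) (hg : Continuous g) (w : Config (N + 1) (Fin 3) T3)
    (x₀ : T3) :
    Continuous fun s : ℝ => weight σ χ g r s (freeFlight (Torus.geometry (Fin 3)) s w) x₀ := by
  unfold weight
  exact (hχ.comp (continuous_id.prodMk continuous_const)).mul
    (hg.comp (continuous_const.mul (continuous_mollDensity_flight r w x₀)))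

/-- **Continuity of the free-streaming rate of the weight along a flight** at a good centre of
`S_t w` (`∂ₛχ` jointly continuous, `g′` continuous, `continuousAt_densRate_flight`). [folklore] -/
theorem continuousAt_weightRate_flight (hχ : Continuous χ)
    (hχ' : Continuous fun p : ℝ × T3 => deriv (fun s => χ (s, p.2)) p.1) (hg : ContDiff ℝ 1 g)
    (hr2 : r < 1 / 2) (w : Config (N + 1) (Fin 3) T3) (t : ℝ) {x₀ : T3}
    (hx : ∀ k, Torus.euclidDist ((freeFlight (Torus.geometry (Fin 3)) t w) k).1 x₀ ≠ 0 ∧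
      Torus.euclidDist ((freeFlight (Torus.geometry (Fin 3)) t w) k).1 x₀ ≠ r) :
    ContinuousAt (fun s : ℝ => weightRate σ χ g r s (freeFlight (Torus.geometry (Fin 3)) s w) x₀)
      t := by
  unfold weightRate
  have h1 : Continuous fun s : ℝ => deriv (fun s' => χ (s', x₀)) s := by
    simpa only [Function.comp_def, id_eq] using hχ'.comp (continuous_id.prodMk continuous_const)
  have h2 : Continuous fun s : ℝ => χ (s, x₀) := hχ.comp (continuous_id.prodMk continuous_const)
  have hρ := continuous_mollDensity_flight r w x₀
  have h3 : Continuous fun s : ℝ =>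
      g (σ ^ 3 * mollDensity r (freeFlight (Torus.geometry (Fin 3)) s w) x₀) :=
    hg.continuous.comp (continuous_const.mul hρ)
  have h4 : Continuous fun s : ℝ =>
      deriv g (σ ^ 3 * mollDensity r (freeFlight (Torus.geometry (Fin 3)) s w) x₀) :=
    (hg.continuous_deriv le_rfl).comp (continuous_const.mul hρ)
  have h5 := continuousAt_densRate_flight hr2 w t hx
  exact (h1.mul h3).continuousAt.add (((h2.mul h4).continuousAt).mul (continuousAt_const.mul h5))

/-! ## In the centre -/

/-- The weight is continuous in the centre. [folklore] -/
theorem continuous_weight_centre (hχ : Continuous χ) (hg : Continuous g) (s : ℝ)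
    (z : Config (N + 1) (Fin 3) T3) : Continuous fun x₀ : T3 => weight σ χ g r s z x₀ := by
  unfold weight
  exact (hχ.comp (continuous_const.prodMk continuous_id)).mul
    (hg.comp (continuous_const.mul (continuous_mollDensity_comp r continuous_const continuous_id)))

/-- The free-streaming rate of the weight is Borel measurable in the centre. [folklore] -/
theorem measurable_weightRate_centre (hχ : Continuous χ)
    (hχ' : Continuous fun p : ℝ × T3 => deriv (fun s => χ (s, p.2)) p.1) (hg : ContDiff ℝ 1 g)
    (s : ℝ) (z : Config (N + 1) (Fin 3) T3) :
    Measurable fun x₀ : T3 => weightRate σ χ g r s z x₀ := by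
  unfold weightRate
  have hρ : Continuous fun x₀ : T3 => mollDensity r z x₀ :=
    continuous_mollDensity_comp r continuous_const continuous_id
  have h1 : Continuous fun x₀ : T3 => deriv (fun s' => χ (s', x₀)) s := by
    simpa only [Function.comp_def, id_eq] using hχ'.comp (continuous_const.prodMk continuous_id)
  have h2 : Continuous fun x₀ : T3 => χ (s, x₀) := hχ.comp (continuous_const.prodMk continuous_id)
  have h3 : Continuous fun x₀ : T3 => g (σ ^ 3 * mollDensity r z x₀) :=
    hg.continuous.comp (continuous_const.mul hρ)
  have h4 : Continuous fun x₀ : T3 => deriv g (σ ^ 3 * mollDensity r z x₀) :=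
    (hg.continuous_deriv le_rfl).comp (continuous_const.mul hρ)
  exact (h1.mul h3).measurable.add
    ((h2.mul h4).measurable.mul (measurable_const.mul (measurable_densRate r z)))

/-! ## Quantitative bounds -/

/-- The argument `σ³ρ_r` of `g` lies in `[0, σ³ · 3/(πr³)]` (`0 ≤ σ`, `0 < r`). [folklore] -/
theorem cube_mul_mollDensity_mem_Icc {σ : ℝ} (hσ : 0 ≤ σ) (hr : 0 < r)
    (z : Config (N + 1) (Fin 3) T3) (x₀ : T3) :
    σ ^ 3 * mollDensity r z x₀ ∈ Icc 0 (σ ^ 3 * (3 / (Real.pi * r ^ 3))) := by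
  have h := mollDensity_mem_Icc hr z x₀
  exact ⟨mul_nonneg (pow_nonneg hσ 3) h.1, mul_le_mul_of_nonneg_left h.2 (pow_nonneg hσ 3)⟩

/-- Sup bound of the weight: `|W| ≤ M_χ M_g`. [folklore] -/
theorem abs_weight_le {σ : ℝ} (hσ : 0 ≤ σ) (hr : 0 < r) {S : Set ℝ} {Mχ Mg : ℝ}
    (hχM : ∀ s ∈ S, ∀ x : T3, |χ (s, x)| ≤ Mχ)
    (hgM : ∀ y ∈ Icc 0 (σ ^ 3 * (3 / (Real.pi * r ^ 3))), |g y| ≤ Mg) {s : ℝ} (hs : s ∈ S)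
    (z : Config (N + 1) (Fin 3) T3) (x₀ : T3) : |weight σ χ g r s z x₀| ≤ Mχ * Mg := by
  unfold weight
  rw [abs_mul]
  exact mul_le_mul (hχM s hs x₀) (hgM _ (cube_mul_mollDensity_mem_Icc hσ hr z x₀)) (abs_nonneg _)
    ((abs_nonneg _).trans (hχM s hs x₀))

/-- Sup bound of the free-streaming rate of the weight along a flight:
`|Ẇ| ≤ M_χ' M_g + M_χ M_g' σ³ · 3/(πr⁴) Σ_k ‖v_k‖`. [folklore] -/
theorem abs_weightRate_le {σ : ℝ} (hσ : 0 ≤ σ) (hr : 0 < r) {S : Set ℝ} {Mχ Mχ' Mg Mg' : ℝ}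
    (hχM : ∀ s ∈ S, ∀ x : T3, |χ (s, x)| ≤ Mχ)
    (hχM' : ∀ s ∈ S, ∀ x : T3, |deriv (fun s' => χ (s', x)) s| ≤ Mχ')
    (hgM : ∀ y ∈ Icc 0 (σ ^ 3 * (3 / (Real.pi * r ^ 3))), |g y| ≤ Mg)
    (hgM' : ∀ y ∈ Icc 0 (σ ^ 3 * (3 / (Real.pi * r ^ 3))), |deriv g y| ≤ Mg') {s : ℝ} (hs : s ∈ S)
    (z : Config (N + 1) (Fin 3) T3) (x₀ : T3) :
    |weightRate σ χ g r s z x₀| ≤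
      Mχ' * Mg + Mχ * Mg' * (σ ^ 3 * (3 / (Real.pi * r ^ 4) * ∑ k, ‖(z k).2‖)) := by
  unfold weightRate
  have hI := cube_mul_mollDensity_mem_Icc hσ hr z x₀
  have hMχ : 0 ≤ Mχ := (abs_nonneg _).trans (hχM s hs x₀)
  have hMg' : 0 ≤ Mg' := (abs_nonneg _).trans (hgM' _ hI)
  refine (abs_add_le (_ : ℝ) _).trans (add_le_add ?_ ?_)
  · rw [abs_mul]
    exact mul_le_mul (hχM' s hs x₀) (hgM _ hI) (abs_nonneg _) ((abs_nonneg _).trans (hχM' s hs x₀))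
  · rw [abs_mul, abs_mul, abs_mul, abs_of_nonneg (pow_nonneg hσ 3)]
    refine mul_le_mul (mul_le_mul (hχM s hs x₀) (hgM' _ hI) (abs_nonneg _) hMχ) ?_
      (by positivity) (mul_nonneg hMχ hMg')
    exact mul_le_mul_of_nonneg_left (abs_densRate_le hr z x₀) (pow_nonneg hσ 3)

/-- Algebra: the difference of two triple products. [folklore] -/
theorem abs_mul_mul_sub_mul_mul_le (a b c a' b' c' : ℝ) :
    |a * b * c - a' * b' * c'| ≤
      |a - a'| * |b| * |c| + |a'| * |b - b'| * |c| + |a'| * |b'| * |c - c'| := by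
  have e : a * b * c - a' * b' * c' =
      (a - a') * b * c + a' * (b - b') * c + a' * b' * (c - c') := by ring
  rw [e]
  calc |(a - a') * b * c + a' * (b - b') * c + a' * b' * (c - c')|
      ≤ |(a - a') * b * c + a' * (b - b') * c| + |a' * b' * (c - c')| := abs_add_le _ _
    _ ≤ |(a - a') * b * c| + |a' * (b - b') * c| + |a' * b' * (c - c')| :=
        add_le_add (abs_add_le _ _) le_rfl
    _ = |a - a'| * |b| * |c| + |a'| * |b - b'| * |c| + |a'| * |b'| * |c - c'| := by
        simp only [abs_mul]

/-- A `C¹` function with `|g′| ≤ M_g'` on an interval is `M_g'`-Lipschitz there. [folklore] -/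
theorem abs_sub_le_of_deriv_le (hg : ContDiff ℝ 1 g) {a b Mg' : ℝ}
    (hgM' : ∀ y ∈ Icc a b, |deriv g y| ≤ Mg') {y y' : ℝ} (hy : y ∈ Icc a b)
    (hy' : y' ∈ Icc a b) : |g y - g y'| ≤ Mg' * |y - y'| := by
  have key := (convex_Icc a b).norm_image_sub_le_of_norm_hasDerivWithin_le
    (fun x _ => ((hg.differentiable one_ne_zero) x).hasDerivAt.hasDerivWithinAt)
    (fun x hx => (Real.norm_eq_abs _).trans_le (hgM' x hx)) hy' hy
  rwa [Real.norm_eq_abs, Real.norm_eq_abs] at key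

/-- The same for `s ↦ χ(s, x)` on a convex time set. [folklore] -/
theorem abs_chi_sub_le_of_deriv_le (hχd : ∀ x₀, Differentiable ℝ fun s => χ (s, x₀)) {S : Set ℝ}
    (hS : Convex ℝ S) {Mχ' : ℝ} (hχM' : ∀ s ∈ S, ∀ x : T3, |deriv (fun s' => χ (s', x)) s| ≤ Mχ')
    (x : T3) {s s' : ℝ} (hs : s ∈ S) (hs' : s' ∈ S) :
    |χ (s, x) - χ (s', x)| ≤ Mχ' * |s - s'| := by
  have key := hS.norm_image_sub_le_of_norm_hasDerivWithin_le
    (f := fun s => χ (s, x)) (fun t _ => ((hχd x) t).hasDerivAt.hasDerivWithinAt)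
    (fun t ht => (Real.norm_eq_abs _).trans_le (hχM' t ht x)) hs' hs
  rwa [Real.norm_eq_abs, Real.norm_eq_abs] at key

/-- **Time-Lipschitz bound of the weight along a flight, uniform in the centre**: on a convex
time set `S` carrying the sup bounds `M_χ, M_χ'` of `χ, ∂ₛχ`,
`|W(s) − W(s')| ≤ (M_χ' M_g + M_χ M_g' σ³ · 3/(πr⁴) Σ_k ‖v_k‖) |s − s'|` (`abs_mollDensity_flight_sub_le`).
[folklore] -/
theorem abs_weight_flight_sub_le {σ : ℝ} (hσ : 0 ≤ σ) (hχd : ∀ x₀, Differentiable ℝ fun s => χ (s, x₀))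
    (hg : ContDiff ℝ 1 g) (hr : 0 < r) {S : Set ℝ} (hS : Convex ℝ S) {Mχ Mχ' Mg Mg' : ℝ}
    (hχM : ∀ s ∈ S, ∀ x : T3, |χ (s, x)| ≤ Mχ)
    (hχM' : ∀ s ∈ S, ∀ x : T3, |deriv (fun s' => χ (s', x)) s| ≤ Mχ')
    (hgM : ∀ y ∈ Icc 0 (σ ^ 3 * (3 / (Real.pi * r ^ 3))), |g y| ≤ Mg)
    (hgM' : ∀ y ∈ Icc 0 (σ ^ 3 * (3 / (Real.pi * r ^ 3))), |deriv g y| ≤ Mg')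
    (w : Config (N + 1) (Fin 3) T3) (x₀ : T3) {s s' : ℝ} (hs : s ∈ S) (hs' : s' ∈ S) :
    |weight σ χ g r s (freeFlight (Torus.geometry (Fin 3)) s w) x₀ -
        weight σ χ g r s' (freeFlight (Torus.geometry (Fin 3)) s' w) x₀| ≤
      (Mχ' * Mg + Mχ * (Mg' * (σ ^ 3 * (3 / (Real.pi * r ^ 4) * ∑ k, ‖(w k).2‖)))) * |s - s'| := by
  unfold weight
  set ρs := mollDensity r (freeFlight (Torus.geometry (Fin 3)) s w) x₀ with hρs
  set ρs' := mollDensity r (freeFlight (Torus.geometry (Fin 3)) s' w) x₀ with hρs'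
  have hI := cube_mul_mollDensity_mem_Icc hσ hr (freeFlight (Torus.geometry (Fin 3)) s w) x₀
  have hI' := cube_mul_mollDensity_mem_Icc hσ hr (freeFlight (Torus.geometry (Fin 3)) s' w) x₀
  have hMχ : 0 ≤ Mχ := (abs_nonneg _).trans (hχM s hs x₀)
  have hMg' : 0 ≤ Mg' := (abs_nonneg _).trans (hgM' _ hI)
  have h1 := abs_chi_sub_le_of_deriv_le hχd hS hχM' x₀ hs hs'
  have h2 : |g (σ ^ 3 * ρs) - g (σ ^ 3 * ρs')| ≤
      Mg' * (σ ^ 3 * (3 / (Real.pi * r ^ 4) * ∑ k, ‖(w k).2‖)) * |s - s'| := by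
    refine (abs_sub_le_of_deriv_le hg hgM' hI hI').trans ?_
    rw [← mul_sub, abs_mul, abs_of_nonneg (pow_nonneg hσ 3), mul_assoc, mul_assoc, mul_assoc]
    refine mul_le_mul_of_nonneg_left (mul_le_mul_of_nonneg_left ?_ (pow_nonneg hσ 3)) hMg'
    have h := abs_mollDensity_flight_sub_le hr w x₀ s s'
    simpa only [mul_assoc] using h
  calc |χ (s, x₀) * g (σ ^ 3 * ρs) - χ (s', x₀) * g (σ ^ 3 * ρs')|
      = |χ (s, x₀) * g (σ ^ 3 * ρs) * 1 - χ (s', x₀) * g (σ ^ 3 * ρs') * 1| := by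
        rw [mul_one, mul_one]
    _ ≤ |χ (s, x₀) - χ (s', x₀)| * |g (σ ^ 3 * ρs)| * |(1 : ℝ)| +
          |χ (s', x₀)| * |g (σ ^ 3 * ρs) - g (σ ^ 3 * ρs')| * |(1 : ℝ)| +
          |χ (s', x₀)| * |g (σ ^ 3 * ρs')| * |(1 : ℝ) - 1| := abs_mul_mul_sub_mul_mul_le _ _ _ _ _ _
    _ = |χ (s, x₀) - χ (s', x₀)| * |g (σ ^ 3 * ρs)| +
          |χ (s', x₀)| * |g (σ ^ 3 * ρs) - g (σ ^ 3 * ρs')| := by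
        rw [abs_one, sub_self, abs_zero, mul_one, mul_one, mul_zero, add_zero]
    _ ≤ Mχ' * |s - s'| * Mg +
          Mχ * (Mg' * (σ ^ 3 * (3 / (Real.pi * r ^ 4) * ∑ k, ‖(w k).2‖)) * |s - s'|) := by
        refine add_le_add (mul_le_mul h1 (hgM _ hI) (abs_nonneg _) ?_)
          (mul_le_mul (hχM s' hs' x₀) h2 (abs_nonneg _) hMχ)
        exact mul_nonneg ((abs_nonneg _).trans (hχM' s hs x₀)) (abs_nonneg _)
    _ = (Mχ' * Mg + Mχ * (Mg' * (σ ^ 3 * (3 / (Real.pi * r ^ 4) * ∑ k, ‖(w k).2‖)))) *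
          |s - s'| := by ring

end Weight

end Summit.AtomisticToContinuum.HydrodynamicLimit.Theorems.EvenStressEnskog

end
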